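/-
Copyright (c) 2026 the pub-hodgecm-mathlib formalisation cell (harness21).  Prover seat hodgecm-mathlib-LH4-p05 (g8), Track A «(D-RAM) FOUR-FRAME» squad, helper lane on
h413 = stmt-HodgeConjecture-24833 (count-neutral).  Heir dealer∕pen LH4-plan (g13) WORD #82 (B) «B2b-3 + END = LH4-p05 (chain owner)»; the END junction of the (β) chain
onto the STAGE-B TABLE, after LH4-p11 (g8)'s (A_L) `F0P3cDyRamLabelledOddStageAOfRecord` (labelled-odd Stage A, unconditional).  2026-09-04.
-/
import Summits.HodgeConjecture.HodgeConjecture.Theorems.F0P3cDyRamCleanSgnOfEightfold              -- ★ p860363 (this seat): `dyadicFence_cleanSgnFrameConstLawAt_derived_ofRecord_of_eightfold` (stub type ⇐ h8)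
import Summits.HodgeConjecture.HodgeConjecture.Theorems.F0P3cDyRamLabelledOddStageAOfRecord        -- ★ (LH4-p11 (g8), (A_L)): `sum_sign_mul_ncard_shell_valueClass_eq_zero_of_finsum_eq_zero`
import Literature.NumberTheory.Automorphic.UnitaryThreeFourFrameFixedCosetDictionary                  -- ★ `v_eq_one_of_mul_map_eq_one`
import HarnessLib

/-!
# Crux `H413`, line LH4 «(D-RAM) FOUR-FRAME» — THE (β) CHAIN ONTO THE STAGE-B TABLE: the tier-0 letter `stub_law_cleanSgn` follows from ONE statement about normalised
# lattices — «the labelled-odd table over the clean-shell normalised stable lattices of `diag(α, β, 1)` sums to zero» (B2b-3's target, by name)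

Cell `hodgecm-mathlib` (D-0151), FLOOR 0, crux item H413 = `stmt-HodgeConjecture-24833`, route `HCCMUnconditional`; squad F0∕P3c∕LH4.  THEOREMS ONLY (no `def`, no instance, no
notation, no `sorry`, default heartbeats); ★-only imports; lane `--supports stmt-HodgeConjecture-24833 --as helper`; pays NO row, states NO law (the table identity is a HYPOTHESIS —
the Stage-B target of F0P3-p01 (g36) B2b-1, LH4-p13 (g8) B2b-2, LH4-p14 (g6) B3 and this seat's table sum B2b-3); import cone ∌ the (β) consumer ★ p859751.

THE COMPOSITION.  ★ p860363 §2: `stub_law_cleanSgn`'s type ⇐ `h8` (the eightfold odd-character vanishing of the class-`+` clean-shell counts in the models `diag(u^{s})`, LH4-p11's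
★ p860156 binder).  LH4-p11's (A_L) ★ `sum_sign_mul_ncard_shell_valueClass_eq_zero_of_finsum_eq_zero` (labelled-odd Stage A: ★ p860198 re-index ∘ ★ p860424 per-orbit fibre
identity (LH4-p10) ∘ ★ p860280 engine; label equivariance ★ p860316) gives each summand block of `h8` from the vanishing of the LABELLED-ODD TABLE
`Σᶠ_{M₀ ∈ 𝓛₀(T), clean shell} labelledOddCount σ ϖ 0 i (valueClassLabel σ ϖ (α−1) (β−1) m* d) M₀ ∕ [𝒰 : N S̃'(M₀)]` (★ DEFS p860257).  Feeding it the element datum's unit∕regularity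
clauses (`|α| = |β| = 1` from `α·σα = β·σβ = 1`; `α ≠ β`, `α ≠ 1`, `β ≠ 1`) and `ϖ ≠ 0` gives (§1) the h8 block at `x = (α−1, β−1)`, `(ℓ, mc, m) = (d%2, mcOfRecord d, mstarOfRecord d)`
(the label clause of h8 IS `valueClassLabel … M d_s` by `Iff.rfl`; `|α| = 1` by ★ `v_eq_one_of_mul_map_eq_one`), hence (§2) **`stub_law_cleanSgn`'s type ⇐ the TABLE identity ALONE** — the one remaining letter of the (β) road,
a statement about finitely many normalised lattices per element datum, no frames, no four-frame family, no label-plus∕minus bookkeeping left.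
HONEST LABEL.  Count-neutral composition; the table identity, (β-BAL), (β) and the tier-0 T₊ row are OPEN; `HC_CM` is proved only modulo the 7 printed citations (2 remaining named
inputs: hLiu418 = `stmt-HodgeConjecture-24832`, h413 = `stmt-HodgeConjecture-24833`) until rung 0 closes.

## References
* [Rogawski1990] J. D. Rogawski, *Automorphic Representations of Unitary Groups in Three Variables*, Ann. of Math. Stud. 123 (1990): §4.9 Prop. 4.9.1 (a)(b) p. 55, §4.10 p. 58.
* [Kottwitz1986BaseChangeUnits] R. E. Kottwitz, *Base change for unit elements of Hecke algebras*, Compositio Math. 60 (1986), §1 pp. 240–241 (κ-orbital integrals as signed lattice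
  counts modulo the diagonal torus).
* [LanglandsShelstad1987] R. P. Langlands, D. Shelstad, *On the definition of transfer factors*, Math. Ann. 278 (1987), §1.3, §3.
-/

set_option autoImplicit false

noncomputable section

namespace Summit.HodgeConjecture.HodgeConjecture.Cruxes.H413.F0P3cDyRamCleanSgnOfOddTable

open Literature.NumberTheory.Automorphic Literature.NumberTheory.Automorphic.HermitianLattice Literature.NumberTheory.Automorphic.UnitaryGroup
open Literature.NumberTheory.Automorphic.UnitaryLatticeTree Literature.NumberTheory.Automorphic.UnitaryThreeFourFrame
open Summit.HodgeConjecture.HodgeConjecture.Cruxes.H413.F0P3cDyRamFourFrameLawDefs (DyadicFence)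
open Summit.HodgeConjecture.HodgeConjecture.Cruxes.H413.F0P3cDyRamFourFramePieces
open Summit.HodgeConjecture.HodgeConjecture.Cruxes.H413.F0P3cDyRamFourFrameCensusDefs
open Summit.HodgeConjecture.HodgeConjecture.Cruxes.H413.F0P3cDyRamStageOneBDefs
open Summit.HodgeConjecture.HodgeConjecture.Cruxes.H413.F0P3cDyRamStageOneBDerivedDefs
open Summit.HodgeConjecture.HodgeConjecture.Cruxes.H413.F0P3cDyRamDiagonalTorusDefs
open Summit.HodgeConjecture.HodgeConjecture.Cruxes.H413.F0P3cDyRamLabelledOddCountDefs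
open Summit.HodgeConjecture.HodgeConjecture.Cruxes.H413.F0P3cDyRamCleanSgnOfEightfold
open Summit.HodgeConjecture.HodgeConjecture.Cruxes.H413.F0P3cDyRamLabelledOddStageAOfRecord
open scoped Matrix MatrixGroups WithZero Valued

/-! ## §1  The h8 block of one (datum, u, element datum, T, i) from the table identity -/

section Block

variable {K : Type} [Field K] [Valued K ℤᵐ⁰] [Fintype 𝓀[K]]

/-- **THE h8 BLOCK FROM THE TABLE.**  At a ramified datum, for a `σ`-fixed non-norm unit `u` with the index-two dichotomy, an element datum `(α, β; n)` at threshold `N₀`,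
`T = diag(α, β, 1)` and a slot `i`: if the labelled-odd table over the clean-shell normalised stable lattices of `T` vanishes (shell `(ℓ, mc)`, label level `m`), then the signed
eightfold class-`+` count of ★ p860156's `h8` vanishes at `(ℓ, mc, m)` — LH4-p11's (A_L) fed with the datum's unit and regularity clauses.
[cite: Kottwitz1986BaseChangeUnits, §1 pp. 240–241] [cite: LanglandsShelstad1987, §1.3, §3] [cite: Rogawski1990, §4.9 Prop. 4.9.1 (a)(b) p. 55] -/
theorem sum_sign_mul_ncard_eq_zero_of_table {σ : K →+* K} {ϖ : K} {d t : ℕ} (hD : IsRamifiedQuadraticDatum σ ϖ d t)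
    {u : K} (hσu : σ u = u) (hvu : Valued.v u = 1) (hun : ¬ ∃ z : K, z * σ z = u)
    (hdich : ∀ x : K, σ x = x → x ≠ 0 → (∃ z : K, z * σ z = x) ∨ ∃ z : K, z * σ z = u * x)
    {N₀ : ℕ} {α β : K} {n₁ n₂ n₃ : ℕ} (hE : IsElementDatum σ ϖ N₀ α β n₁ n₂ n₃)
    (T : GL (Fin 3) K) (hT : (T : Matrix (Fin 3) (Fin 3) K) = Matrix.diagonal ![α, β, 1]) (ℓ mc m : ℕ) (i : Fin 3)
    (hB : ∑ᶠ M₀ ∈ {M | M ∈ normalisedStableLattices T ∧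
          (LatticeInLevel ϖ ℓ (Matrix.diagonal ![α - 1, β - 1, 0]) M ∧ ¬ LatticeInLevel ϖ (ℓ + 1) (Matrix.diagonal ![α - 1, β - 1, 0]) M ∧
            LatticeInLevel ϖ mc (Matrix.diagonal ![(α - 1) * (α - 1), (β - 1) * (β - 1), 0]) M)},
        (labelledOddCount σ ϖ 0 i (valueClassLabel σ ϖ (α - 1) (β - 1) m d) M₀ : ℚ) /
          ((((unitStabilizer M₀).map (unitNormMap σ 3)).relIndex (fixedUnitTorus σ 3) : ℕ) : ℚ) = 0) :
    (∑ e : Fin 3 → Bool, (if e i then (-1 : ℤ) else 1) *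
        ({M : Submodule 𝒪[K] (Fin 3 → K) | IsVertexLattice σ ϖ (Matrix.diagonal fun j => if e j then u else (1 : K)) 0 M ∧ mapGL T M = M ∧
          ((LatticeInLevel ϖ ℓ (Matrix.diagonal ![α - 1, β - 1, 0]) M ∧ ¬ LatticeInLevel ϖ (ℓ + 1) (Matrix.diagonal ![α - 1, β - 1, 0]) M ∧
              LatticeInLevel ϖ mc (Matrix.diagonal ![(α - 1) * (α - 1), (β - 1) * (β - 1), 0]) M) ∧
            {v | ∃ y ∈ M, Valued.v ((ϖ ^ m)⁻¹ *
                (v - ((if e 0 then u else (1 : K)) * (α - 1) * (y 0 * σ (y 0)) + (if e 1 then u else (1 : K)) * (β - 1) * (y 1 * σ (y 1))))) ≤ 1} =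
              valueSetMod σ ϖ m (xPlus σ ϖ d))}.ncard : ℤ)) = 0 := by
  obtain ⟨hσ, hvσ, hϖ, -⟩ := id hD
  obtain ⟨hα, hβ, hαβ, hα1, hβ1, -⟩ := id hE
  have hϖ0 : ϖ ≠ 0 := fun h => by rw [h, map_zero] at hϖ; exact (WithZero.coe_ne_zero hϖ.symm).elim
  have hs : ∀ j : Fin 3, Valued.v ((![α, β, 1] : Fin 3 → K) j) = 1 := by
    intro j
    fin_cases j
    · exact UnitaryThreeFourFrame.v_eq_one_of_mul_map_eq_one hvσ hα
    · exact UnitaryThreeFourFrame.v_eq_one_of_mul_map_eq_one hvσ hβ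
    · simp
  have hreg : ∀ j k : Fin 3, j ≠ k → (![α, β, 1] : Fin 3 → K) j ≠ (![α, β, 1] : Fin 3 → K) k := by
    intro j k hjk
    fin_cases j <;> fin_cases k
    all_goals first | exact absurd rfl hjk | simp
    · exact hαβ
    · exact hα1
    · exact fun h => hαβ h.symm
    · exact hβ1
    · exact fun h => hα1 h.symm
    · exact fun h => hβ1 h.symm
  exact sum_sign_mul_ncard_shell_valueClass_eq_zero_of_finsum_eq_zero hσ hvσ hϖ (Units.mk0 ϖ hϖ0) rfl hσu hvu hun hdich hs hreg T hT
    (α - 1) (β - 1) ℓ mc m d i hB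

end Block

/-! ## §2  `stub_law_cleanSgn`'s type from the table identity alone -/

/-- **THE (β) ROAD ONTO THE STAGE-B TABLE.**  If, behind the dyadic fence at every datum, for every `σ`-fixed non-norm unit `u` with the index-two dichotomy, every element datum
above `n0DerivedOfRecord d`, `T = diag(α, β, 1)` and each slot `i : Fin 3`, the labelled-odd table over the clean-shell `(d%2, mcOfRecord d)` normalised stable lattices of `T` with
the value-class label at `m* = mstarOfRecord d` vanishes, then (β) `CleanSgnFrameConstLawAt n0DerivedOfRecord mcOfRecord` holds (dyadically fenced) at every datum — the type
of the tier-0 letter `stub_law_cleanSgn`: §1 block by block into ★ p860363 §2.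
[cite: Rogawski1990, §4.9 Prop. 4.9.1 (a)(b) p. 55, §4.10 p. 58] [cite: Kottwitz1986BaseChangeUnits, §1 pp. 240–241] [cite: LanglandsShelstad1987, §1.3, §3] -/
theorem dyadicFence_cleanSgnFrameConstLawAt_derived_ofRecord_of_table
    (hB : ∀ {K : Type} [Field K] [Valued K ℤᵐ⁰] [CompleteSpace K] [Fintype 𝓀[K]] (σ : K →+* K) (ϖ : K) (d t : ℕ),
      Valued.v (2 : K) < 1 → IsRamifiedQuadraticDatum σ ϖ d t →
      ∀ (u : K), σ u = u → Valued.v u = 1 → (¬ ∃ z : K, z * σ z = u) →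
        (∀ x : K, σ x = x → x ≠ 0 → (∃ z : K, z * σ z = x) ∨ ∃ z : K, z * σ z = u * x) →
      ∀ (α β : K) (n₁ n₂ n₃ : ℕ), IsElementDatum σ ϖ (n0DerivedOfRecord d) α β n₁ n₂ n₃ →
      ∀ (T : GL (Fin 3) K), (T : Matrix (Fin 3) (Fin 3) K) = Matrix.diagonal ![α, β, 1] →
      ∀ i : Fin 3,
        ∑ᶠ M₀ ∈ {M | M ∈ normalisedStableLattices T ∧
            (LatticeInLevel ϖ (d % 2) (Matrix.diagonal ![α - 1, β - 1, 0]) M ∧ ¬ LatticeInLevel ϖ (d % 2 + 1) (Matrix.diagonal ![α - 1, β - 1, 0]) M ∧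
              LatticeInLevel ϖ (mcOfRecord d) (Matrix.diagonal ![(α - 1) * (α - 1), (β - 1) * (β - 1), 0]) M)},
          (labelledOddCount σ ϖ 0 i (valueClassLabel σ ϖ (α - 1) (β - 1) (mstarOfRecord d) d) M₀ : ℚ) /
            ((((unitStabilizer M₀).map (unitNormMap σ 3)).relIndex (fixedUnitTorus σ 3) : ℕ) : ℚ) = 0) :
    ∀ {K : Type} [Field K] [Valued K ℤᵐ⁰] [CompleteSpace K] [Fintype 𝓀[K]] (σ : K →+* K) (ϖ : K) (d t : ℕ),
      DyadicFence (K := K) (CleanSgnFrameConstLawAt n0DerivedOfRecord mcOfRecord σ ϖ d t) :=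
  dyadicFence_cleanSgnFrameConstLawAt_derived_ofRecord_of_eightfold
    fun σ ϖ d t h2 hD u hσu hvu hun hdich α β n₁ n₂ n₃ hE T hT i =>
      sum_sign_mul_ncard_eq_zero_of_table hD hσu hvu hun hdich hE T hT (d % 2) (mcOfRecord d) (mstarOfRecord d) i
        (hB σ ϖ d t h2 hD u hσu hvu hun hdich α β n₁ n₂ n₃ hE T hT i)

end Summit.HodgeConjecture.HodgeConjecture.Cruxes.H413.F0P3cDyRamCleanSgnOfOddTable

end
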